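import Summits.Ventures.HodgeRepro2.T5HeckeAdjoint
import Summits.Ventures.HodgeRepro2.T5HeckeCommutativeMultiplicityOne

/-!
# The Hecke eigencharacter of the contragredient is the eigencharacter composed with `T ↦ T^∨`

Kernel annex of the Tier-5 record (blind lane).  From the adjointness
`⟨T • l, v⟩ = ⟨l, T^∨ • v⟩` of `T5HeckeAdjoint` (`T^∨ = transposeOp T`, `T_g^∨ = T_{g⁻¹}`) and
`(π̃)^K ≅ (π^K)^*` of `T5SmoothDualRep`:

* `heckeSMul_smoothDualRep_eq_smul_of_transposeOp` — if `T^∨` acts on `π^K` by the scalar `c`, then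
  `T` acts on `(π̃)^K` by the same scalar `c`;
* `heckeSMul_smoothDualRep_eq_heckeCharacter_transposeOp_smul` — for commutative `H(G, K)` and
  irreducible `π` with `π^K ≠ 0` (`T5HeckeCommutativeMultiplicityOne`): `T • l = χ_π(T^∨) • l` on
  `(π̃)^K`;
* `heckeCharacter_smoothDualRep_eq` — when `π̃` is itself irreducible `K`-finite with `(π̃)^K ≠ 0`
  (the hypotheses of `heckeCharacter` for `π̃`; `T5SmoothDualIrreducible` supplies them for smooth
  admissible `π`): `χ_{π̃}(T) = χ_π(T^∨)`, and `heckeCharacter_smoothDualRep_doubleCosetOp`: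
  `χ_{π̃}(T_g) = χ_π(T_{g⁻¹})` — «the Satake parameter of the contragredient is the inverse».

What stays prose: the unimodularity of the specific group (here the counting form
`hU : #(Kg⁻¹K/K) = #(KgK/K)`), the commutativity of the specific `H(G, K)`, the printed theorems.
-/

namespace Summit.Ventures.HodgeRepro2.T5HeckeContragredientCharacter

open T5HeckePermutationModule T5HeckeTranspose T5HeckeAdjoint T5SmoothDualRep
  T5HeckeCommutativeMultiplicityOne LevelPositivity

variable {G : Type*} [Group G] [TopologicalSpace G] [IsTopologicalGroup G] {k : Type*} [Field k]
  {V : Type*} [AddCommGroup V] [Module k V] (ρ : Representation k G V) {K : Subgroup G}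

/-- If `T^∨` acts on `π^K` by the scalar `c`, then `T` acts on `(π̃)^K` by `c`:
`⟨T • l, v⟩ = ⟨l, T^∨ • v⟩ = c ⟨l, v⟩` for all `v ∈ π^K`, and `(π̃)^K → (π^K)^*` is injective. -/
theorem heckeSMul_smoothDualRep_eq_smul_of_transposeOp [CharZero k]
    (hK : ∀ g : G, Finite (MulAction.orbit K (g : G ⧸ K)))
    (hU : ∀ g : G, (MulAction.orbit K ((g⁻¹ : G) : G ⧸ K)).ncard =
      (MulAction.orbit K ((g : G) : G ⧸ K)).ncard)
    (hopen : IsOpen (K : Set G)) (hρ : T5LevelIdempotent.KFinite ρ K)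
    (T : heckeAlgebra k K) {c : k}
    (hT : ∀ w : invariants ρ K, heckeSMul ρ (transposeOp hK T) w = c • w)
    (l : invariants (smoothDualRep ρ) K) :
    heckeSMul (smoothDualRep ρ) T l = c • l := by
  apply (invariantsSmoothDualRepEquiv ρ hopen hρ).injective
  rw [LinearEquiv.map_smul]
  ext w
  rw [LinearMap.smul_apply, invariantsSmoothDualRepEquiv_apply, invariantsSmoothDualRepEquiv_apply,
    apply_heckeSMul_eq_apply_heckeSMul_transposeOp ρ hK hU T l w, hT w, Submodule.coe_smul,
    LinearMap.map_smul, smul_eq_mul]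

/-- For commutative `H(G, K)` and irreducible `K`-finite `π` with `0 ≠ π^K` finite-dimensional:
`T • l = χ_π(T^∨) • l` on `(π̃)^K`, `χ_π` the eigencharacter of `T5HeckeCommutativeMultiplicityOne`. -/
theorem heckeSMul_smoothDualRep_eq_heckeCharacter_transposeOp_smul [CharZero k] [ρ.IsIrreducible]
    [IsAlgClosed k] (hK : ∀ g : G, Finite (MulAction.orbit K (g : G ⧸ K)))
    (hU : ∀ g : G, (MulAction.orbit K ((g⁻¹ : G) : G ⧸ K)).ncard =
      (MulAction.orbit K ((g : G) : G ⧸ K)).ncard)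
    (hopen : IsOpen (K : Set G)) (hρ : T5LevelIdempotent.KFinite ρ K)
    [FiniteDimensional k (invariants ρ K)] (hne : invariants ρ K ≠ ⊥)
    (hcomm : ∀ T S : heckeAlgebra k K, T * S = S * T) (T : heckeAlgebra k K)
    (l : invariants (smoothDualRep ρ) K) :
    heckeSMul (smoothDualRep ρ) T l = heckeCharacter ρ hρ hK hne hcomm (transposeOp hK T) • l :=
  heckeSMul_smoothDualRep_eq_smul_of_transposeOp ρ hK hU hopen hρ T
    (fun w => heckeSMul_eq_heckeCharacter_smul ρ hρ hK hne hcomm (transposeOp hK T) w) l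

/-- **`χ_{π̃} = χ_π ∘ ∨`**: when the contragredient `π̃` is itself irreducible `K`-finite with
`0 ≠ (π̃)^K` finite-dimensional, its Hecke eigencharacter is `T ↦ χ_π(T^∨)`. -/
theorem heckeCharacter_smoothDualRep_eq [CharZero k] [ρ.IsIrreducible] [IsAlgClosed k]
    (hK : ∀ g : G, Finite (MulAction.orbit K (g : G ⧸ K)))
    (hU : ∀ g : G, (MulAction.orbit K ((g⁻¹ : G) : G ⧸ K)).ncard =
      (MulAction.orbit K ((g : G) : G ⧸ K)).ncard)
    (hopen : IsOpen (K : Set G)) (hρ : T5LevelIdempotent.KFinite ρ K)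
    [FiniteDimensional k (invariants ρ K)] (hne : invariants ρ K ≠ ⊥)
    (hcomm : ∀ T S : heckeAlgebra k K, T * S = S * T)
    [(smoothDualRep ρ).IsIrreducible] (hρ' : T5LevelIdempotent.KFinite (smoothDualRep ρ) K)
    [FiniteDimensional k (invariants (smoothDualRep ρ) K)]
    (hne' : invariants (smoothDualRep ρ) K ≠ ⊥) (T : heckeAlgebra k K) :
    heckeCharacter (smoothDualRep ρ) hρ' hK hne' hcomm T =
      heckeCharacter ρ hρ hK hne hcomm (transposeOp hK T) := by
  obtain ⟨x, hx, hx0⟩ := (Submodule.ne_bot_iff _).1 hne'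
  have hl : (⟨x, hx⟩ : invariants (smoothDualRep ρ) K) ≠ 0 :=
    fun h => hx0 ((Submodule.mk_eq_zero _ hx).1 h)
  exact heckeCharacter_eq_of_smul_eq (smoothDualRep ρ) hρ' hK hne' hcomm hl
    (heckeSMul_smoothDualRep_eq_heckeCharacter_transposeOp_smul ρ hK hU hopen hρ hne hcomm T _)

/-- **The Satake parameter of the contragredient is the inverse**: `χ_{π̃}(T_g) = χ_π(T_{g⁻¹})`. -/
theorem heckeCharacter_smoothDualRep_doubleCosetOp [CharZero k] [ρ.IsIrreducible] [IsAlgClosed k]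
    (hK : ∀ g : G, Finite (MulAction.orbit K (g : G ⧸ K)))
    (hU : ∀ g : G, (MulAction.orbit K ((g⁻¹ : G) : G ⧸ K)).ncard =
      (MulAction.orbit K ((g : G) : G ⧸ K)).ncard)
    (hopen : IsOpen (K : Set G)) (hρ : T5LevelIdempotent.KFinite ρ K)
    [FiniteDimensional k (invariants ρ K)] (hne : invariants ρ K ≠ ⊥)
    (hcomm : ∀ T S : heckeAlgebra k K, T * S = S * T)
    [(smoothDualRep ρ).IsIrreducible] (hρ' : T5LevelIdempotent.KFinite (smoothDualRep ρ) K)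
    [FiniteDimensional k (invariants (smoothDualRep ρ) K)]
    (hne' : invariants (smoothDualRep ρ) K ≠ ⊥) (g : G) :
    haveI := hK g; haveI := hK g⁻¹
    heckeCharacter (smoothDualRep ρ) hρ' hK hne' hcomm (T5HeckeDoubleCoset.doubleCosetOp k K g) =
      heckeCharacter ρ hρ hK hne hcomm (T5HeckeDoubleCoset.doubleCosetOp k K g⁻¹) := by
  haveI := hK g; haveI := hK g⁻¹
  rw [heckeCharacter_smoothDualRep_eq ρ hK hU hopen hρ hne hcomm hρ' hne', transposeOp_doubleCosetOp]

end Summit.Ventures.HodgeRepro2.T5HeckeContragredientCharacter
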